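import Summits.QuantumFields.YangMills.Theorems.BalabanUVNodesN15TwoSpacingGluingCurvedKnitCovariantLandauNodeLeibniz
import Summits.QuantumFields.YangMills.Theorems.BalabanUVNodesN15CovariantLandauNodeFourEntries
import HarnessLib

/-!
# N15 = NE2 — dag-n15-a g33, (♭-8a): 207b's THREE THRESHOLDED GLOBAL LANDAU ROWS FROM THE TWO-GRID η-DEFECT ROW OF `N_V^R` ALONE — n15-c∕233's and n15-c∕234's inline reductions NAMED
# (`landauRows_small_of_flatRows''`, `flatRows_two_grids`), composed (`landauRows_small_of_defectRow`), and the (P-R) operator layer with ALL FOUR ENTRIES CONCRETE modulo that one row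
# (`ne2PlusOperator_sfqr₄E_of_defectRow`)
# (dag-n15-a g33, (♭-8a); node N15 = NE2; `--supports stmt-QuantumFields-27366 --as helper`, count-neutral; four theorems; imports n15-c∕234 (→ 233, 220, 222b), (R8a))

WHY.  n15-c∕234 `ne2PlusOperator_sfqr_of_defectRow … E hE hD` (p749506; «PROGRAMME (P-S) COMPLETE FOR THE ONE-GRID ROWS»: every one-grid row of the Landau letter is a THEOREM — primitive-row
reduction 212–217, four flat rows PROVED (220 King rung; 222∕222b Combes–Thomas), the covariant gradient row by the Leibniz route 224–232 with NO Hölder norms) displays ONLY entries 1–3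
(`hE`) and the two-grid η-defect row of `N_V^R` (`hD`).  PROGRAMME (P-R)₄ ((R1)–(R8b), this seat) removed `hE`.  For the site ∕ unit layers and the four-entries knit to read 234's display, its
reduction must be NAMED (233 and 234 inline theirs, as 219∕221∕223 did — (♭-1)∕(♭-6) pattern).  THIS FILE: `landauRows_small_of_flatRows''` (233's text minus its last line),
`flatRows_two_grids` (234's witness: the flat-row display is hypothesis-free), their composition, and (R8a) on it.

HONEST FRAMING ∕ LIMITS.  Bookkeeping on dag-n15-c's MODEL carriers (doubled-torus cover `2L^{m+1}`, global small-field gauge, one averaging level, unit weights, site transporters, `Q(U)` =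
main term (125) of [B7] (124)); the flat rows are King's `A = 0` MODEL theorems and the T⁴ cell's Combes–Thomas theorem read through exact dictionaries (n15-c's, consumed BY NAME); the
two-grid defect row of `N_V^R` is the ONE remaining HYPOTHESIS of the Landau letter (n15-c's located g24 object (G3)); NOT [Balaban1985BackgroundPropagators] Thms 3.1–3.4 ∕ 3.14 ∕ (3.49)
as printed and no estimate of Bałaban's; NE2⁺ NOT PRINTED; N15 stays DISCHARGED OF RECORD 8∕27 AS CONSUMED (U-blind v7 pin, p687738) — nothing re-claimed, no count moved; K3⁸ OPEN;
finite 𝕋⁴ per index — NOT ℝ⁴ ∕ OS ∕ mass gap ∕ Clay.  `set_option maxRecDepth 8192 in` ×1.  No `sorry`, `instance`, `notation`; standard axioms.  Restate-immune (no Theses import).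
-/

noncomputable section

open scoped BigOperators Matrix

namespace Summit.QuantumFields.YangMills.BalabanUVNodes.N15.Gluing

open Literature.MathematicalPhysics.QuantumFieldTheory.Balaban1983to89
open Literature.MathematicalPhysics.QuantumFieldTheory.Balaban1983to89.B11SectG (BlockNorm HasMaj)
open Literature.MathematicalPhysics.QuantumFieldTheory.Balaban1983to89.T4EtaRateDefect (idef)
open Literature.MathematicalPhysics.QuantumFieldTheory.Balaban1983to89.T4EtaRateCoeffDefect (pull)
open Literature.MathematicalPhysics.QuantumFieldTheory.Balaban1983to89.B6UnitTorusCarrier (unitTorusGeo unitTorusGeo_dist_nonneg)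
open Literature.MathematicalPhysics.QuantumFieldTheory.Balaban1983to89.B5Prop11Plancherel (Tor fine unitVec)
open Literature.MathematicalPhysics.QuantumFieldTheory.Balaban1983to89.T4EtaRate (NE2PlusOperator rateFactor)
open Literature.MathematicalPhysics.QuantumFieldTheory.King1986 (aK aK_pos aK_le aK_ge)
open Literature.MathematicalPhysics.QuantumFieldTheory.King1986.Torus (blockOf tdistT)
open Literature.Barriers.QuantumFields (traceForm)
open Summit.QuantumFields.YangMills.BalabanUVNodes.N15.BackgroundLayer (gavgM)
open Summit.QuantumFields.YangMills.BalabanUVNodes.N15.VectorPiece (kingPrV blkFine_comp_kingPrV bshiftEquiv)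
open Summit.QuantumFields.YangMills.BalabanUVNodes.N15.MatrixSpecies (liftBlk liftMap basisConst basisConst_nonneg)
open Summit.QuantumFields.YangMills.BalabanUVNodes.N15.OperatorReadout (opGeo)
open Summit.QuantumFields.YangMills.BalabanUVNodes.N15.CovLandau (flatKernelRows_king flatSopRow_ct_uniform cgrad csavg cGreen cSop landauCov landauSmallConst landauRowConst landauLetterConst_nonneg landauCov_eq_of_mass landauCov_one_eq mulVecLin_sub' cPL cAL cXL cYL)
open Summit.QuantumFields.YangMills.BalabanUVNodes.N15.CurvedSpecies (exp_smul_unitary_of_conjTranspose)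
open Summit.QuantumFields.YangMills.BalabanUVNodes.N15.SiteLayerSf (norm_gavgM_le_of_norm_le)

variable {d : ℕ} {L : ℕ} [NeZero L]

section Node

open scoped Matrix.Norms.L2Operator

variable (d) (mm ι : Type) [Fintype mm] [DecidableEq mm] [Nonempty mm] [Fintype ι] [DecidableEq ι] (e : Matrix mm mm ℂ ≃L[ℝ] (ι → ℝ))

/-- ★★ **207b's THREE THRESHOLDED GLOBAL LANDAU ROWS FROM n15-c∕233's DISPLAY** (`hF` = the four FLAT rows per grid ONLY, mass window; `hD` = the two-grid defect row): n15-c∕233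
`ne2PlusOperator_sfqr_of_flatRows''`'s INLINE reduction NAMED (proof text = 233's minus its last line; the covariant gradient row is a THEOREM by n15-c's Leibniz route 224–232, letters
from Reg335).  MODEL; the displayed rows are HYPOTHESES; NOT [B9] Thms 3.1–3.4 as printed.
[cite: Balaban1985BackgroundPropagators, (3.49) p.399, Thm 3.4 p.400, (3.35)–(3.37) p.396 (shape); Balaban1984PropagatorsII, Props. 2.2–2.3 pp.228–231 (the flat rows' shape)] -/
theorem landauRows_small_of_flatRows'' (hL : Odd L ∧ 1 < L) (hL7 : 7 ≤ L) {a : ℝ} (ha : 0 < a) {c35 : ℝ} (hc35 : 0 < c35)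
    (hF : ∃ δF CG CA CD CS : ℝ, 0 < δF ∧ 0 ≤ CG ∧ 0 ≤ CA ∧ 0 ≤ CD ∧ 0 ≤ CS ∧ ∀ i : SfIdx d L, ∃ awC awF : ℝ, 0 < awC ∧ awC ≤ 1 ∧ 0 < awF ∧ awF ≤ 1 ∧
        (HasMaj (BlockNorm.ofBlocks (unitTorusGeo L i.kk (cvM d L i.m i.kk hL)) (liftBlk (blockOf (L ^ i.kk) (cvM d L i.m i.kk hL)) ι)) (BlockNorm.ofBlocks (unitTorusGeo L i.kk (cvM d L i.m i.kk hL)) (liftBlk (blockOf (L ^ i.kk) (cvM d L i.m i.kk hL)) ι)) (Matrix.mulVecLin (cGreen (cvM d L i.m i.kk hL) (L ^ i.kk) (fun (_ : Fin (d + 1)) (_ : Tor (fine (L ^ i.kk) (cvM d L i.m i.kk hL))) => (1 : Matrix ι ι ℝ)) (awC * ((L ^ i.kk : ℕ) : ℝ) ^ (d + 1)))) (fun y y' => CG * Real.exp (-(δF * (unitTorusGeo L i.kk (cvM d L i.m i.kk hL)).dist y y'))) ∧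
          HasMaj (BlockNorm.ofBlocks (unitTorusGeo L i.kk (cvM d L i.m i.kk hL)) (liftBlk (fun b : Tor (fine (L ^ i.kk) (cvM d L i.m i.kk hL)) × Fin (d + 1) => blockOf (L ^ i.kk) (cvM d L i.m i.kk hL) b.1) ι)) (BlockNorm.ofBlocks (unitTorusGeo L i.kk (cvM d L i.m i.kk hL)) (liftBlk (blockOf (L ^ i.kk) (cvM d L i.m i.kk hL)) ι)) (Matrix.mulVecLin (cGreen (cvM d L i.m i.kk hL) (L ^ i.kk) (fun (_ : Fin (d + 1)) (_ : Tor (fine (L ^ i.kk) (cvM d L i.m i.kk hL))) => (1 : Matrix ι ι ℝ)) (awC * ((L ^ i.kk : ℕ) : ℝ) ^ (d + 1)) * (cgrad (cvM d L i.m i.kk hL) (L ^ i.kk) (fun (_ : Fin (d + 1)) (_ : Tor (fine (L ^ i.kk) (cvM d L i.m i.kk hL))) => (1 : Matrix ι ι ℝ)))ᵀ)) (fun y y' => CA * Real.exp (-(δF * (unitTorusGeo L i.kk (cvM d L i.m i.kk hL)).dist y y'))) ∧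
          HasMaj (BlockNorm.ofBlocks (unitTorusGeo L i.kk (cvM d L i.m i.kk hL)) (liftBlk (blockOf (L ^ i.kk) (cvM d L i.m i.kk hL)) ι)) (BlockNorm.ofBlocks (unitTorusGeo L i.kk (cvM d L i.m i.kk hL)) (liftBlk (fun b : Tor (fine (L ^ i.kk) (cvM d L i.m i.kk hL)) × Fin (d + 1) => blockOf (L ^ i.kk) (cvM d L i.m i.kk hL) b.1) ι)) (Matrix.mulVecLin (cgrad (cvM d L i.m i.kk hL) (L ^ i.kk) (fun (_ : Fin (d + 1)) (_ : Tor (fine (L ^ i.kk) (cvM d L i.m i.kk hL))) => (1 : Matrix ι ι ℝ)) * cGreen (cvM d L i.m i.kk hL) (L ^ i.kk) (fun (_ : Fin (d + 1)) (_ : Tor (fine (L ^ i.kk) (cvM d L i.m i.kk hL))) => (1 : Matrix ι ι ℝ)) (awC * ((L ^ i.kk : ℕ) : ℝ) ^ (d + 1)))) (fun y y' => CD * Real.exp (-(δF * (unitTorusGeo L i.kk (cvM d L i.m i.kk hL)).dist y y'))) ∧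
          HasMaj (BlockNorm.ofBlocks (unitTorusGeo L i.kk (cvM d L i.m i.kk hL)) (liftBlk (fun y : Tor (cvM d L i.m i.kk hL) => y) ι)) (BlockNorm.ofBlocks (unitTorusGeo L i.kk (cvM d L i.m i.kk hL)) (liftBlk (fun y : Tor (cvM d L i.m i.kk hL) => y) ι)) (Matrix.mulVecLin (cSop (cvM d L i.m i.kk hL) (L ^ i.kk) (fun (_ : Fin (d + 1)) (_ : Tor (fine (L ^ i.kk) (cvM d L i.m i.kk hL))) => (1 : Matrix ι ι ℝ)) (awC * ((L ^ i.kk : ℕ) : ℝ) ^ (d + 1)))⁻¹) (fun y y' => CS * ((L ^ i.kk : ℕ) : ℝ) ^ (d + 1) * Real.exp (-(δF * (unitTorusGeo L i.kk (cvM d L i.m i.kk hL)).dist y y')))) ∧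
        (HasMaj (BlockNorm.ofBlocks (unitTorusGeo L i.kk (cvM d L i.m i.kk hL)) (liftBlk (blockOf (L ^ i.r * L ^ i.kk) (cvM d L i.m i.kk hL)) ι)) (BlockNorm.ofBlocks (unitTorusGeo L i.kk (cvM d L i.m i.kk hL)) (liftBlk (blockOf (L ^ i.r * L ^ i.kk) (cvM d L i.m i.kk hL)) ι)) (Matrix.mulVecLin (cGreen (cvM d L i.m i.kk hL) (L ^ i.r * L ^ i.kk) (fun (_ : Fin (d + 1)) (_ : Tor (fine (L ^ i.r * L ^ i.kk) (cvM d L i.m i.kk hL))) => (1 : Matrix ι ι ℝ)) (awF * ((L ^ i.r * L ^ i.kk : ℕ) : ℝ) ^ (d + 1)))) (fun y y' => CG * Real.exp (-(δF * (unitTorusGeo L i.kk (cvM d L i.m i.kk hL)).dist y y'))) ∧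
          HasMaj (BlockNorm.ofBlocks (unitTorusGeo L i.kk (cvM d L i.m i.kk hL)) (liftBlk (fun b : Tor (fine (L ^ i.r * L ^ i.kk) (cvM d L i.m i.kk hL)) × Fin (d + 1) => blockOf (L ^ i.r * L ^ i.kk) (cvM d L i.m i.kk hL) b.1) ι)) (BlockNorm.ofBlocks (unitTorusGeo L i.kk (cvM d L i.m i.kk hL)) (liftBlk (blockOf (L ^ i.r * L ^ i.kk) (cvM d L i.m i.kk hL)) ι)) (Matrix.mulVecLin (cGreen (cvM d L i.m i.kk hL) (L ^ i.r * L ^ i.kk) (fun (_ : Fin (d + 1)) (_ : Tor (fine (L ^ i.r * L ^ i.kk) (cvM d L i.m i.kk hL))) => (1 : Matrix ι ι ℝ)) (awF * ((L ^ i.r * L ^ i.kk : ℕ) : ℝ) ^ (d + 1)) * (cgrad (cvM d L i.m i.kk hL) (L ^ i.r * L ^ i.kk) (fun (_ : Fin (d + 1)) (_ : Tor (fine (L ^ i.r * L ^ i.kk) (cvM d L i.m i.kk hL))) => (1 : Matrix ι ι ℝ)))ᵀ)) (fun y y' => CA * Real.exp (-(δF * (unitTorusGeo L i.kk (cvM d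 L i.m i.kk hL)).dist y y'))) ∧
          HasMaj (BlockNorm.ofBlocks (unitTorusGeo L i.kk (cvM d L i.m i.kk hL)) (liftBlk (blockOf (L ^ i.r * L ^ i.kk) (cvM d L i.m i.kk hL)) ι)) (BlockNorm.ofBlocks (unitTorusGeo L i.kk (cvM d L i.m i.kk hL)) (liftBlk (fun b : Tor (fine (L ^ i.r * L ^ i.kk) (cvM d L i.m i.kk hL)) × Fin (d + 1) => blockOf (L ^ i.r * L ^ i.kk) (cvM d L i.m i.kk hL) b.1) ι)) (Matrix.mulVecLin (cgrad (cvM d L i.m i.kk hL) (L ^ i.r * L ^ i.kk) (fun (_ : Fin (d + 1)) (_ : Tor (fine (L ^ i.r * L ^ i.kk) (cvM d L i.m i.kk hL))) => (1 : Matrix ι ι ℝ)) * cGreen (cvM d L i.m i.kk hL) (L ^ i.r * L ^ i.kk) (fun (_ : Fin (d + 1)) (_ : Tor (fine (L ^ i.r * L ^ i.kk) (cvM d L i.m i.kk hL))) => (1 : Matrix ι ι ℝ)) (awF * ((L ^ i.r * L ^ i.kk : ℕ) : ℝ) ^ (d + 1)))) (fun y y' => CD * Real.exp (-(δF * (unitTorusGeo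 L i.kk (cvM d L i.m i.kk hL)).dist y y'))) ∧
          HasMaj (BlockNorm.ofBlocks (unitTorusGeo L i.kk (cvM d L i.m i.kk hL)) (liftBlk (fun y : Tor (cvM d L i.m i.kk hL) => y) ι)) (BlockNorm.ofBlocks (unitTorusGeo L i.kk (cvM d L i.m i.kk hL)) (liftBlk (fun y : Tor (cvM d L i.m i.kk hL) => y) ι)) (Matrix.mulVecLin (cSop (cvM d L i.m i.kk hL) (L ^ i.r * L ^ i.kk) (fun (_ : Fin (d + 1)) (_ : Tor (fine (L ^ i.r * L ^ i.kk) (cvM d L i.m i.kk hL))) => (1 : Matrix ι ι ℝ)) (awF * ((L ^ i.r * L ^ i.kk : ℕ) : ℝ) ^ (d + 1)))⁻¹) (fun y y' => CS * ((L ^ i.r * L ^ i.kk : ℕ) : ℝ) ^ (d + 1) * Real.exp (-(δF * (unitTorusGeo L i.kk (cvM d L i.m i.kk hL)).dist y y')))))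
    (hD : ∃ δD CR γR aD : ℝ, 0 < δD ∧ 0 ≤ CR ∧ 0 < γR ∧ 0 < aD ∧
      ∀ i : SfIdx d L, ∀ α₀ : ℝ, 0 < α₀ → (L : ℝ) ^ i.m * α₀ ≤ aD → ∀ A' : Fin (d + 1) → CvX' d L i.m i.kk i.r hL → Matrix mm mm ℂ, (sfInstance d mm ι hL i).Bf.Reg335 c35 α₀ A' →
        HasMaj (CvNorm d L i.m i.kk hL ι) (BlockNorm.ofBlocks (unitTorusGeo L i.kk (cvM d L i.m i.kk hL)) (liftBlk (cvBlk d L i.m i.kk hL ∘ (kingPrV L i.kk i.r (cvM d L i.m i.kk hL))) ι)) (idef (pull (liftMap (kingPrV L i.kk i.r (cvM d L i.m i.kk hL)) ι)) (pull (liftMap (kingPrV L i.kk i.r (cvM d L i.m i.kk hL)) ι)) (cvNVr' d L i.m i.kk i.r hL a ι e (fun μ x' => NormedSpace.exp (((((L ^ i.r * L ^ i.kk : ℕ) : ℝ))⁻¹) • A' μ x'))) (cvNVr d L i.m i.kk hL a ι e (fun μ x => NormedSpace.exp (((((L ^ i.kk : ℕ) : ℝ))⁻¹) • gavgM (Matrix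 mm mm ℂ) (Fin (d + 1)) (kingPrV L i.kk i.r (cvM d L i.m i.kk hL)) A' μ x)))) (fun y y' => (CR * ((L : ℝ) ^ i.kk) ^ (-γR)) * Real.exp (-(δD * (unitTorusGeo L i.kk (cvM d L i.m i.kk hL)).dist y y')))) :
    ∃ δR cR CR γR aG : ℝ, 0 < δR ∧ 0 ≤ cR ∧ 0 ≤ CR ∧ 0 < γR ∧ 0 < aG ∧
      ∀ i : SfIdx d L, ∀ α₀ : ℝ, 0 < α₀ → (L : ℝ) ^ i.m * α₀ ≤ aG → ∀ A' : Fin (d + 1) → CvX' d L i.m i.kk i.r hL → Matrix mm mm ℂ, (sfInstance d mm ι hL i).Bf.Reg335 c35 α₀ A' →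
        HasMaj (CvNorm d L i.m i.kk hL ι) (CvNorm d L i.m i.kk hL ι) (cvNVr d L i.m i.kk hL a ι e (fun μ x => NormedSpace.exp (((((L ^ i.kk : ℕ) : ℝ))⁻¹) • gavgM (Matrix mm mm ℂ) (Fin (d + 1)) (kingPrV L i.kk i.r (cvM d L i.m i.kk hL)) A' μ x))) (fun y y' => (cR * (c35 * (L : ℝ) ^ i.m * α₀)) * Real.exp (-(δR * (unitTorusGeo L i.kk (cvM d L i.m i.kk hL)).dist y y'))) ∧
        HasMaj (BlockNorm.ofBlocks (unitTorusGeo L i.kk (cvM d L i.m i.kk hL)) (liftBlk (cvBlk d L i.m i.kk hL ∘ (kingPrV L i.kk i.r (cvM d L i.m i.kk hL))) ι)) (BlockNorm.ofBlocks (unitTorusGeo L i.kk (cvM d L i.m i.kk hL)) (liftBlk (cvBlk d L i.m i.kk hL ∘ (kingPrV L i.kk i.r (cvM d L i.m i.kk hL))) ι)) (cvNVr' d L i.m i.kk i.r hL a ι e (fun μ x' => NormedSpace.exp (((((L ^ i.r * L ^ i.kk : ℕ) : ℝ))⁻¹) • A' μ x'))) (fun y y' => (cR * (c35 * (L : ℝ)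 ^ i.m * α₀)) * Real.exp (-(δR * (unitTorusGeo L i.kk (cvM d L i.m i.kk hL)).dist y y'))) ∧
        HasMaj (CvNorm d L i.m i.kk hL ι) (BlockNorm.ofBlocks (unitTorusGeo L i.kk (cvM d L i.m i.kk hL)) (liftBlk (cvBlk d L i.m i.kk hL ∘ (kingPrV L i.kk i.r (cvM d L i.m i.kk hL))) ι)) (idef (pull (liftMap (kingPrV L i.kk i.r (cvM d L i.m i.kk hL)) ι)) (pull (liftMap (kingPrV L i.kk i.r (cvM d L i.m i.kk hL)) ι)) (cvNVr' d L i.m i.kk i.r hL a ι e (fun μ x' => NormedSpace.exp (((((L ^ i.r * L ^ i.kk : ℕ) : ℝ))⁻¹) • A' μ x'))) (cvNVr d L i.m i.kk hL a ι e (fun μ x => NormedSpace.exp (((((L ^ i.kk : ℕ) : ℝ))⁻¹) • gavgM (Matrix mm mm ℂ) (Fin (d + 1)) (kingPrV L i.kk i.r (cvM d L i.m i.kk hL)) A' μ x)))) (fun y y' => (CR * ((L : ℝ) ^ i.kk) ^ (-γR)) * Real.exp (-(δR * (unitTorusGeo L i.kk (cvM d L i.m i.kk hL)).dist y y'))) :=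 by
  obtain ⟨δF, CG, CA, CD, CS, hδF, hCG, hCA, hCD, hCS, hF⟩ := hF
  obtain ⟨δD, CR, γR, aD, hδD, hCR, hγR, haD, hD⟩ := hD
  have hLpos : 0 < L := Nat.pos_of_ne_zero (NeZero.ne L)
  have hLr : (0 : ℝ) < (L : ℝ) := Nat.cast_pos.mpr hLpos
  -- the constants of n15-c∕218 (index-free)
  have hκF := @basisConst_nonneg ι _ (Matrix mm mm ℂ) Matrix.frobeniusNormedAddCommGroup Matrix.frobeniusNormedSpace e
  have hκm : (0 : ℝ) ≤ (@basisConst ι _ (Matrix mm mm ℂ) Matrix.frobeniusNormedAddCommGroup Matrix.frobeniusNormedSpace e * (2 * Real.sqrt (Fintype.card mm)) * Real.sqrt (Fintype.card mm)) := by positivity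
  have hcs8 : 0 ≤ B4Sect5Proof.latticeConst (d + 1) (δF / 8) := B4Sect5Proof.latticeConst_nonneg (d + 1) (by positivity)
  have hcs : 0 ≤ B4Sect5Proof.latticeConst (d + 1) (δF / 2 / 16) := B4Sect5Proof.latticeConst_nonneg (d + 1) (by positivity)
  have hcs' : 0 ≤ B4Sect5Proof.latticeConst (d + 1) (3 * (δF / 2) / 4 / 8) := B4Sect5Proof.latticeConst_nonneg (d + 1) (by positivity)
  have hthr : 0 < landauExpThreshold2 ((d : ℝ) + 1) (Fintype.card ι) (@basisConst ι _ (Matrix mm mm ℂ) Matrix.frobeniusNormedAddCommGroup Matrix.frobeniusNormedSpace e * (2 * Real.sqrt (Fintype.card mm)) * Real.sqrt (Fintype.card mm)) CG CA CD CS (B4Sect5Proof.latticeConst (d + 1) (δF / 8)) (B4Sect5Proof.latticeConst (d + 1) (δF / 2 / 16)) δF :=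
    landauExpThreshold2_pos (by positivity) (Nat.cast_nonneg _) hκm hCG hCA hCD hCS hcs8 hcs
  have hcR : 0 ≤ landauRowConst ((d : ℝ) + 1) (Fintype.card ι) CG CA CD CS (cPL ((d : ℝ) + 1) CG CD (2 * Fintype.card ι * (@basisConst ι _ (Matrix mm mm ℂ) Matrix.frobeniusNormedAddCommGroup Matrix.frobeniusNormedSpace e * (2 * Real.sqrt (Fintype.card mm)) * Real.sqrt (Fintype.card mm))) (Real.exp 1 * Fintype.card ι * (@basisConst ι _ (Matrix mm mm ℂ) Matrix.frobeniusNormedAddCommGroup Matrix.frobeniusNormedSpace e * (2 * Real.sqrt (Fintype.card mm)) * Real.sqrt (Fintype.card mm))) (2 * ((d : ℝ) + 1) * (2 * Fintype.card ι * (@basisConst ι _ (Matrix mm mm ℂ) Matrix.frobeniusNormedAddCommGroup Matrix.frobeniusNormedSpace e * (2 * Real.sqrt (Fintype.card mm)) * Real.sqrt (Fintype.card mm)))) 1 (B4Sect5Proof.latticeConst (d + 1) (δF / 8)) δF (δF / 8)) (2 * Fintype.card ι * (@basisConst ι _ (Matrix mm mm ℂ) Matrix.frobeniusNormedAddCommGroup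 Matrix.frobeniusNormedSpace e * (2 * Real.sqrt (Fintype.card mm)) * Real.sqrt (Fintype.card mm))) (2 * ((d : ℝ) + 1) * (2 * Fintype.card ι * (@basisConst ι _ (Matrix mm mm ℂ) Matrix.frobeniusNormedAddCommGroup Matrix.frobeniusNormedSpace e * (2 * Real.sqrt (Fintype.card mm)) * Real.sqrt (Fintype.card mm)))) 1
      (B4Sect5Proof.latticeConst (d + 1) (δF / 2 / 16)) (B4Sect5Proof.latticeConst (d + 1) (3 * (δF / 2) / 4 / 8)) (δF / 2) := by
    unfold landauRowConst
    have hP0 : 0 ≤ (cPL ((d : ℝ) + 1) CG CD (2 * Fintype.card ι * (@basisConst ι _ (Matrix mm mm ℂ) Matrix.frobeniusNormedAddCommGroup Matrix.frobeniusNormedSpace e * (2 * Real.sqrt (Fintype.card mm)) * Real.sqrt (Fintype.card mm))) (Real.exp 1 * Fintype.card ι * (@basisConst ι _ (Matrix mm mm ℂ) Matrix.frobeniusNormedAddCommGroup Matrix.frobeniusNormedSpace e * (2 * Real.sqrt (Fintype.card mm)) * Real.sqrt (Fintype.card mm))) (2 * ((d : ℝ) + 1) * (2 * Fintype.card ι *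 (@basisConst ι _ (Matrix mm mm ℂ) Matrix.frobeniusNormedAddCommGroup Matrix.frobeniusNormedSpace e * (2 * Real.sqrt (Fintype.card mm)) * Real.sqrt (Fintype.card mm)))) 1 (B4Sect5Proof.latticeConst (d + 1) (δF / 8)) δF (δF / 8)) := by unfold cPL cAL cYL; positivity
    exact landauLetterConst_nonneg (by positivity) (by positivity) hcs' (by positivity) (by unfold CovLandau.cM2 CovLandau.cA0; positivity) hCD hP0
      (by unfold CovLandau.cPG0 CovLandau.cA0; positivity) (by norm_num) (by positivity)
  refine ⟨min (3 * (δF / 2) / 8) δD, _, CR, γR, min aD ((landauExpThreshold2 ((d : ℝ) + 1) (Fintype.card ι) (@basisConst ι _ (Matrix mm mm ℂ) Matrix.frobeniusNormedAddCommGroup Matrix.frobeniusNormedSpace e * (2 * Real.sqrt (Fintype.card mm)) * Real.sqrt (Fintype.card mm)) CG CA CD CS (B4Sect5Proof.latticeConst (d + 1) (δF / 8)) (B4Sect5Proof.latticeConst (d + 1) (δF / 2 / 16)) δF / c35)),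
    lt_min (by positivity) hδD, hcR, hCR, hγR, lt_min haD (by positivity), fun i α₀ hα₀ hMa A' hA' => ?_⟩
  -- the class, the sizes
  have hMaD : (L : ℝ) ^ i.m * α₀ ≤ aD := hMa.trans (min_le_left _ _)
  have hMaT : (L : ℝ) ^ i.m * α₀ ≤ landauExpThreshold2 ((d : ℝ) + 1) (Fintype.card ι) (@basisConst ι _ (Matrix mm mm ℂ) Matrix.frobeniusNormedAddCommGroup Matrix.frobeniusNormedSpace e * (2 * Real.sqrt (Fintype.card mm)) * Real.sqrt (Fintype.card mm)) CG CA CD CS (B4Sect5Proof.latticeConst (d + 1) (δF / 8)) (B4Sect5Proof.latticeConst (d + 1) (δF / 2 / 16)) δF / c35 :=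
    hMa.trans (min_le_right _ _)
  have hrA0 : 0 ≤ c35 * (L : ℝ) ^ i.m * α₀ := by positivity
  have hrT : c35 * (L : ℝ) ^ i.m * α₀ ≤ landauExpThreshold2 ((d : ℝ) + 1) (Fintype.card ι) (@basisConst ι _ (Matrix mm mm ℂ) Matrix.frobeniusNormedAddCommGroup Matrix.frobeniusNormedSpace e * (2 * Real.sqrt (Fintype.card mm)) * Real.sqrt (Fintype.card mm)) CG CA CD CS (B4Sect5Proof.latticeConst (d + 1) (δF / 8)) (B4Sect5Proof.latticeConst (d + 1) (δF / 2 / 16)) δF := by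
    have := mul_le_mul_of_nonneg_left hMaT hc35.le
    rw [mul_div_cancel₀ _ hc35.ne'] at this
    simpa only [mul_assoc] using this
  obtain ⟨hskew, h1F, h2F, h3F⟩ := (sfInstance_reg335_iff d mm ι hL i c35 α₀ A').1 hA'
  have h1 : ∀ μ x', ‖A' μ x'‖ ≤ c35 * (L : ℝ) ^ i.m * α₀ := fun μ x' => (l2_opNorm_le_frobenius_norm _).trans (h1F μ x')
  have hĀs : ∀ μ x, (gavgM (Matrix mm mm ℂ) (Fin (d + 1)) (kingPrV L i.kk i.r (cvM d L i.m i.kk hL)) A' μ x)ᴴ = -gavgM (Matrix mm mm ℂ) (Fin (d + 1)) (kingPrV L i.kk i.r (cvM d L i.m i.kk hL)) A' μ x :=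
    fun μ x => gavgM_conjTranspose_of_skew (kingPrV L i.kk i.r (cvM d L i.m i.kk hL)) hskew μ x
  have hĀ : ∀ μ x, ‖gavgM (Matrix mm mm ℂ) (Fin (d + 1)) (kingPrV L i.kk i.r (cvM d L i.m i.kk hL)) A' μ x‖ ≤ c35 * (L : ℝ) ^ i.m * α₀ :=
    fun μ x => (l2_opNorm_le_frobenius_norm _).trans (norm_gavgM_le_of_norm_le d mm hL i hrA0 h1F μ x)
  obtain ⟨awC, awF, hawC0, hawC1, hawF0, hawF1, ⟨hG1c, hA1c, hD1c, hS1c⟩, ⟨hG1f, hA1f, hD1f, hS1f⟩⟩ := hF i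
  -- the Lipschitz sizes ((3.35)'s second member): fine `ℓ′ = r/n′`, coarse `ℓ = L^r·ℓ′` (block means, n15-c∕233a)
  have hb0 : 0 ≤ c35 * (L : ℝ) ^ i.m * α₀ * (((L : ℝ) ^ i.kk)⁻¹ * ((L : ℝ) ^ i.r)⁻¹) := by positivity
  have h2 : ∀ μ κ x', ‖A' μ (bshiftEquiv (cvM d L i.m i.kk hL) (L ^ i.r * L ^ i.kk) κ x') - A' μ x'‖ ≤ c35 * (L : ℝ) ^ i.m * α₀ * (((L : ℝ) ^ i.kk)⁻¹ * ((L : ℝ) ^ i.r)⁻¹) :=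
    fun μ κ x' => (l2_opNorm_le_frobenius_norm _).trans (h2F μ κ x')
  have hℓf : ∀ μ (z : Tor (fine (L ^ i.r * L ^ i.kk) (cvM d L i.m i.kk hL))), ‖A' μ (z, μ) - A' μ (z - unitVec (fine (L ^ i.r * L ^ i.kk) (cvM d L i.m i.kk hL)) μ, μ)‖ ≤
      c35 * (L : ℝ) ^ i.m * α₀ * (((L : ℝ) ^ i.kk)⁻¹ * ((L : ℝ) ^ i.r)⁻¹) := by
    intro μ z
    have h := h2 μ μ (z - unitVec (fine (L ^ i.r * L ^ i.kk) (cvM d L i.m i.kk hL)) μ, μ)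
    simpa [bshiftEquiv] using h
  have hℓc : ∀ μ (z : Tor (fine (L ^ i.kk) (cvM d L i.m i.kk hL))), ‖gavgM (Matrix mm mm ℂ) (Fin (d + 1)) (kingPrV L i.kk i.r (cvM d L i.m i.kk hL)) A' μ (z, μ) -
      gavgM (Matrix mm mm ℂ) (Fin (d + 1)) (kingPrV L i.kk i.r (cvM d L i.m i.kk hL)) A' μ (z - unitVec (fine (L ^ i.kk) (cvM d L i.m i.kk hL)) μ, μ)‖ ≤
      (L ^ i.r : ℕ) * (c35 * (L : ℝ) ^ i.m * α₀ * (((L : ℝ) ^ i.kk)⁻¹ * ((L : ℝ) ^ i.r)⁻¹)) :=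
    fun μ z => norm_gavgM_sub_shift_le (cvM d L i.m i.kk hL) i.kk i.r A' h2 μ μ μ z
  have hnℓf : ((L ^ i.r * L ^ i.kk : ℕ) : ℝ) * (c35 * (L : ℝ) ^ i.m * α₀ * (((L : ℝ) ^ i.kk)⁻¹ * ((L : ℝ) ^ i.r)⁻¹)) ≤ c35 * (L : ℝ) ^ i.m * α₀ := by
    have hk : (0 : ℝ) < (L : ℝ) ^ i.kk := pow_pos hLr _
    have hr' : (0 : ℝ) < (L : ℝ) ^ i.r := pow_pos hLr _
    refine le_of_eq ?_
    push_cast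
    field_simp
  have hnℓc : ((L ^ i.kk : ℕ) : ℝ) * ((L ^ i.r : ℕ) * (c35 * (L : ℝ) ^ i.m * α₀ * (((L : ℝ) ^ i.kk)⁻¹ * ((L : ℝ) ^ i.r)⁻¹))) ≤ c35 * (L : ℝ) ^ i.m * α₀ := by
    have hk : (0 : ℝ) < (L : ℝ) ^ i.kk := pow_pos hLr _
    have hr' : (0 : ℝ) < (L : ℝ) ^ i.r := pow_pos hLr _
    refine le_of_eq ?_
    push_cast
    field_simp
  -- n15-c∕232 on both grids
  have keyC := hasMaj_landauCov_sub_exp_of_flat'' (cvM d L i.m i.kk hL) (L ^ i.kk) L i.kk e hawC0 hawC1 hĀs hrA0 (by positivity) hĀ hℓc hnℓc hδF hCG hCA hCD hCS hG1c hA1c hD1c hS1c hrT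
  have keyF := hasMaj_landauCov_sub_exp_of_flat'' (cvM d L i.m i.kk hL) (L ^ i.r * L ^ i.kk) L i.kk e hawF0 hawF1 hskew hrA0 hb0 h1 hℓf hnℓf hδF hCG hCA hCD hCS hG1f hA1f hD1f hS1f hrT
  have hd0 := unitTorusGeo_dist_nonneg L i.kk (cvM d L i.m i.kk hL)
  -- unitarity and masses
  have hUc : ∀ ν (p : CvX d L i.m i.kk hL), ((fun μ x => NormedSpace.exp (((((L ^ i.kk : ℕ) : ℝ))⁻¹) • gavgM (Matrix mm mm ℂ) (Fin (d + 1)) (kingPrV L i.kk i.r (cvM d L i.m i.kk hL)) A' μ x)) ν p)ᴴ * (fun μ x => NormedSpace.exp (((((L ^ i.kk : ℕ) : ℝ))⁻¹) • gavgM (Matrix mm mm ℂ) (Fin (d + 1)) (kingPrV L i.kk i.r (cvM d L i.m i.kk hL)) A' μ x)) ν p = 1 := fun ν p => exp_smul_unitary_of_conjTranspose (hĀs ν p) _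
  have hUf : ∀ ν (p : CvX' d L i.m i.kk i.r hL), ((fun μ x' => NormedSpace.exp (((((L ^ i.r * L ^ i.kk : ℕ) : ℝ))⁻¹) • A' μ x')) ν p)ᴴ * (fun μ x' => NormedSpace.exp (((((L ^ i.r * L ^ i.kk : ℕ) : ℝ))⁻¹) • A' μ x')) ν p = 1 := fun ν p => exp_smul_unitary_of_conjTranspose (hskew ν p) _
  have hTc := isUnit_cvT₀ e hUc
  have hTf := isUnit_cvT₀ e hUf
  have haC : (0 : ℝ) < (awC * ((L ^ i.kk : ℕ) : ℝ) ^ (d + 1)) := mul_pos hawC0 (pow_pos (Nat.cast_pos.mpr (pow_pos hLpos _)) _)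
  have haF : (0 : ℝ) < (awF * ((L ^ i.r * L ^ i.kk : ℕ) : ℝ) ^ (d + 1)) := mul_pos hawF0 (pow_pos (Nat.cast_pos.mpr (Nat.mul_pos (pow_pos hLpos _) (pow_pos hLpos _))) _)
  refine ⟨?_, ?_, ?_⟩
  · -- the coarse global row
    rw [cvNVr, cvLandau, landauCov_eq_of_mass _ _ hTc ha haC, ← landauCov_one_eq _ _ haC ι, ← mulVecLin_sub']
    exact keyC.of_rate_le hd0 (mul_nonneg hcR hrA0) (min_le_left _ _)
  · -- the fine global row: the knit's fine block map IS King's block map at the fine spacing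
    have hBN : BlockNorm.ofBlocks (unitTorusGeo L i.kk (cvM d L i.m i.kk hL)) (liftBlk (cvBlk d L i.m i.kk hL ∘ (kingPrV L i.kk i.r (cvM d L i.m i.kk hL))) ι) =
        BlockNorm.ofBlocks (unitTorusGeo L i.kk (cvM d L i.m i.kk hL)) (liftBlk (fun b : Tor (fine (L ^ i.r * L ^ i.kk) (cvM d L i.m i.kk hL)) × Fin (d + 1) => blockOf (L ^ i.r * L ^ i.kk) (cvM d L i.m i.kk hL) b.1) ι) := by
      congr 1
      funext p
      exact congrFun (blkFine_comp_kingPrV (cvM d L i.m i.kk hL) L i.kk i.r) p.1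
    rw [hBN, cvNVr', cvLandau', landauCov_eq_of_mass _ _ hTf ha haF, ← landauCov_one_eq _ _ haF ι, ← mulVecLin_sub']
    exact keyF.of_rate_le hd0 (mul_nonneg hcR hrA0) (min_le_left _ _)
  · -- the two-grid defect row (displayed)
    exact (hD i α₀ hα₀ hMaD A' hA').of_rate_le hd0 (mul_nonneg hCR (Real.rpow_nonneg (pow_pos hLr _).le _)) (min_le_right _ _)

omit [Nonempty mm] in
/-- ★★★ **n15-c∕233's FLAT-ROW DISPLAY IS A THEOREM** (hypothesis-free): per index and grid, the four FLAT rows {`G′(1)`, `G′(1)∂ᵀ`, `∂G′(1)`, `(Q′G′²Q′ᵀ)⁻¹(1)`} at King's masses `a_K(1,L,·)` —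
n15-c∕220 `flatKernelRows_king` (dag-n15-e's King-model rung) and n15-c∕222b `flatSopRow_ct_uniform` (the T⁴ cell's Combes–Thomas kit on `[1∕2, 1]`); = n15-c∕234
`ne2PlusOperator_sfqr_of_defectRow`'s witness term, NAMED.  MODEL (King `A = 0` rung, CT) read through exact dictionaries.
[cite: Balaban1984PropagatorsII, Props. 2.2–2.3 pp.228–231 (shape); Balaban1983RegularityDecay, Theorem (1.10) p.573; King1986, Thm 3.3 p.656, Prop. 3.9 (3.73) p.665] -/
theorem flatRows_two_grids (hL : Odd L ∧ 1 < L) (hL7 : 7 ≤ L) :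
    ∃ δF CG CA CD CS : ℝ, 0 < δF ∧ 0 ≤ CG ∧ 0 ≤ CA ∧ 0 ≤ CD ∧ 0 ≤ CS ∧ ∀ i : SfIdx d L, ∃ awC awF : ℝ, 0 < awC ∧ awC ≤ 1 ∧ 0 < awF ∧ awF ≤ 1 ∧
        (HasMaj (BlockNorm.ofBlocks (unitTorusGeo L i.kk (cvM d L i.m i.kk hL)) (liftBlk (blockOf (L ^ i.kk) (cvM d L i.m i.kk hL)) ι)) (BlockNorm.ofBlocks (unitTorusGeo L i.kk (cvM d L i.m i.kk hL)) (liftBlk (blockOf (L ^ i.kk) (cvM d L i.m i.kk hL)) ι)) (Matrix.mulVecLin (cGreen (cvM d L i.m i.kk hL) (L ^ i.kk) (fun (_ : Fin (d + 1)) (_ : Tor (fine (L ^ i.kk) (cvM d L i.m i.kk hL))) => (1 : Matrix ι ι ℝ)) (awC * ((L ^ i.kk : ℕ) : ℝ) ^ (d + 1)))) (fun y y' => CG * Real.exp (-(δF * (unitTorusGeo L i.kk (cvM d L i.m i.kk hL)).dist y y'))) ∧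
          HasMaj (BlockNorm.ofBlocks (unitTorusGeo L i.kk (cvM d L i.m i.kk hL)) (liftBlk (fun b : Tor (fine (L ^ i.kk) (cvM d L i.m i.kk hL)) × Fin (d + 1) => blockOf (L ^ i.kk) (cvM d L i.m i.kk hL) b.1) ι)) (BlockNorm.ofBlocks (unitTorusGeo L i.kk (cvM d L i.m i.kk hL)) (liftBlk (blockOf (L ^ i.kk) (cvM d L i.m i.kk hL)) ι)) (Matrix.mulVecLin (cGreen (cvM d L i.m i.kk hL) (L ^ i.kk) (fun (_ : Fin (d + 1)) (_ : Tor (fine (L ^ i.kk) (cvM d L i.m i.kk hL))) => (1 : Matrix ι ι ℝ)) (awC * ((L ^ i.kk : ℕ) : ℝ) ^ (d + 1)) * (cgrad (cvM d L i.m i.kk hL) (L ^ i.kk) (fun (_ : Fin (d + 1)) (_ : Tor (fine (L ^ i.kk) (cvM d L i.m i.kk hL))) => (1 : Matrix ι ι ℝ)))ᵀ)) (fun y y' => CA * Real.exp (-(δF * (unitTorusGeo L i.kk (cvM d L i.m i.kk hL)).dist y y'))) ∧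
          HasMaj (BlockNorm.ofBlocks (unitTorusGeo L i.kk (cvM d L i.m i.kk hL)) (liftBlk (blockOf (L ^ i.kk) (cvM d L i.m i.kk hL)) ι)) (BlockNorm.ofBlocks (unitTorusGeo L i.kk (cvM d L i.m i.kk hL)) (liftBlk (fun b : Tor (fine (L ^ i.kk) (cvM d L i.m i.kk hL)) × Fin (d + 1) => blockOf (L ^ i.kk) (cvM d L i.m i.kk hL) b.1) ι)) (Matrix.mulVecLin (cgrad (cvM d L i.m i.kk hL) (L ^ i.kk) (fun (_ : Fin (d + 1)) (_ : Tor (fine (L ^ i.kk) (cvM d L i.m i.kk hL))) => (1 : Matrix ι ι ℝ)) * cGreen (cvM d L i.m i.kk hL) (L ^ i.kk) (fun (_ : Fin (d + 1)) (_ : Tor (fine (L ^ i.kk) (cvM d L i.m i.kk hL))) => (1 : Matrix ι ι ℝ)) (awC * ((L ^ i.kk : ℕ) : ℝ) ^ (d + 1)))) (fun y y' => CD * Real.exp (-(δF * (unitTorusGeo L i.kk (cvM d L i.m i.kk hL)).dist y y'))) ∧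
          HasMaj (BlockNorm.ofBlocks (unitTorusGeo L i.kk (cvM d L i.m i.kk hL)) (liftBlk (fun y : Tor (cvM d L i.m i.kk hL) => y) ι)) (BlockNorm.ofBlocks (unitTorusGeo L i.kk (cvM d L i.m i.kk hL)) (liftBlk (fun y : Tor (cvM d L i.m i.kk hL) => y) ι)) (Matrix.mulVecLin (cSop (cvM d L i.m i.kk hL) (L ^ i.kk) (fun (_ : Fin (d + 1)) (_ : Tor (fine (L ^ i.kk) (cvM d L i.m i.kk hL))) => (1 : Matrix ι ι ℝ)) (awC * ((L ^ i.kk : ℕ) : ℝ) ^ (d + 1)))⁻¹) (fun y y' => CS * ((L ^ i.kk : ℕ) : ℝ) ^ (d + 1) * Real.exp (-(δF * (unitTorusGeo L i.kk (cvM d L i.m i.kk hL)).dist y y')))) ∧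
        (HasMaj (BlockNorm.ofBlocks (unitTorusGeo L i.kk (cvM d L i.m i.kk hL)) (liftBlk (blockOf (L ^ i.r * L ^ i.kk) (cvM d L i.m i.kk hL)) ι)) (BlockNorm.ofBlocks (unitTorusGeo L i.kk (cvM d L i.m i.kk hL)) (liftBlk (blockOf (L ^ i.r * L ^ i.kk) (cvM d L i.m i.kk hL)) ι)) (Matrix.mulVecLin (cGreen (cvM d L i.m i.kk hL) (L ^ i.r * L ^ i.kk) (fun (_ : Fin (d + 1)) (_ : Tor (fine (L ^ i.r * L ^ i.kk) (cvM d L i.m i.kk hL))) => (1 : Matrix ι ι ℝ)) (awF * ((L ^ i.r * L ^ i.kk : ℕ) : ℝ) ^ (d + 1)))) (fun y y' => CG * Real.exp (-(δF * (unitTorusGeo L i.kk (cvM d L i.m i.kk hL)).dist y y'))) ∧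
          HasMaj (BlockNorm.ofBlocks (unitTorusGeo L i.kk (cvM d L i.m i.kk hL)) (liftBlk (fun b : Tor (fine (L ^ i.r * L ^ i.kk) (cvM d L i.m i.kk hL)) × Fin (d + 1) => blockOf (L ^ i.r * L ^ i.kk) (cvM d L i.m i.kk hL) b.1) ι)) (BlockNorm.ofBlocks (unitTorusGeo L i.kk (cvM d L i.m i.kk hL)) (liftBlk (blockOf (L ^ i.r * L ^ i.kk) (cvM d L i.m i.kk hL)) ι)) (Matrix.mulVecLin (cGreen (cvM d L i.m i.kk hL) (L ^ i.r * L ^ i.kk) (fun (_ : Fin (d + 1)) (_ : Tor (fine (L ^ i.r * L ^ i.kk) (cvM d L i.m i.kk hL))) => (1 : Matrix ι ι ℝ)) (awF * ((L ^ i.r * L ^ i.kk : ℕ) : ℝ) ^ (d + 1)) * (cgrad (cvM d L i.m i.kk hL) (L ^ i.r * L ^ i.kk) (fun (_ : Fin (d + 1)) (_ : Tor (fine (L ^ i.r * L ^ i.kk) (cvM d L i.m i.kk hL))) => (1 : Matrix ι ι ℝ)))ᵀ)) (fun y y' => CA * Real.exp (-(δF * (unitTorusGeo L i.kk (cvM d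 L i.m i.kk hL)).dist y y'))) ∧
          HasMaj (BlockNorm.ofBlocks (unitTorusGeo L i.kk (cvM d L i.m i.kk hL)) (liftBlk (blockOf (L ^ i.r * L ^ i.kk) (cvM d L i.m i.kk hL)) ι)) (BlockNorm.ofBlocks (unitTorusGeo L i.kk (cvM d L i.m i.kk hL)) (liftBlk (fun b : Tor (fine (L ^ i.r * L ^ i.kk) (cvM d L i.m i.kk hL)) × Fin (d + 1) => blockOf (L ^ i.r * L ^ i.kk) (cvM d L i.m i.kk hL) b.1) ι)) (Matrix.mulVecLin (cgrad (cvM d L i.m i.kk hL) (L ^ i.r * L ^ i.kk) (fun (_ : Fin (d + 1)) (_ : Tor (fine (L ^ i.r * L ^ i.kk) (cvM d L i.m i.kk hL))) => (1 : Matrix ι ι ℝ)) * cGreen (cvM d L i.m i.kk hL) (L ^ i.r * L ^ i.kk) (fun (_ : Fin (d + 1)) (_ : Tor (fine (L ^ i.r * L ^ i.kk) (cvM d L i.m i.kk hL))) => (1 : Matrix ι ι ℝ)) (awF * ((L ^ i.r * L ^ i.kk : ℕ) : ℝ) ^ (d + 1)))) (fun y y' => CD * Real.exp (-(δF * (unitTorusGeo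 L i.kk (cvM d L i.m i.kk hL)).dist y y'))) ∧
          HasMaj (BlockNorm.ofBlocks (unitTorusGeo L i.kk (cvM d L i.m i.kk hL)) (liftBlk (fun y : Tor (cvM d L i.m i.kk hL) => y) ι)) (BlockNorm.ofBlocks (unitTorusGeo L i.kk (cvM d L i.m i.kk hL)) (liftBlk (fun y : Tor (cvM d L i.m i.kk hL) => y) ι)) (Matrix.mulVecLin (cSop (cvM d L i.m i.kk hL) (L ^ i.r * L ^ i.kk) (fun (_ : Fin (d + 1)) (_ : Tor (fine (L ^ i.r * L ^ i.kk) (cvM d L i.m i.kk hL))) => (1 : Matrix ι ι ℝ)) (awF * ((L ^ i.r * L ^ i.kk : ℕ) : ℝ) ^ (d + 1)))⁻¹) (fun y y' => CS * ((L ^ i.r * L ^ i.kk : ℕ) : ℝ) ^ (d + 1) * Real.exp (-(δF * (unitTorusGeo L i.kk (cvM d L i.m i.kk hL)).dist y y')))) := by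
  have hL2 : 2 ≤ L := le_trans (by norm_num) hL7
  have hL1r : (1 : ℝ) < (L : ℝ) := by exact_mod_cast hL.2
  have hLr : (0 : ℝ) < (L : ℝ) := by linarith
  have hL2r : (2 : ℝ) ≤ (L : ℝ) := by exact_mod_cast hL2
  obtain ⟨CS, δS, hCS, hδS, HS⟩ := flatSopRow_ct_uniform (d := d) L (a₁ := (1 / 2 : ℝ)) (a₂ := (1 : ℝ)) (by norm_num) (by norm_num)
  obtain ⟨C, δK, hC, hδK, HK⟩ := flatKernelRows_king (d := d) L hL.1 hL2 (a₀ := (1 : ℝ)) one_pos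
  -- King's masses lie in `[1/2, 1]`
  have haKlo : ∀ K : ℕ, 1 ≤ K → (1 / 2 : ℝ) ≤ aK 1 (L : ℝ) K := fun K hK => by
    have h1 := aK_ge one_pos hL1r hK (a := (1 : ℝ))
    have hL4 : (4 : ℝ) ≤ (L : ℝ) ^ 2 := by nlinarith
    have hinv : ((L : ℝ) ^ 2)⁻¹ ≤ 1 / 4 := by rw [one_div]; exact inv_anti₀ (by norm_num) hL4
    linarith
  refine ⟨min δK δS, C, C, C, CS, lt_min hδK hδS, hC.le, hC.le, hC.le, hCS.le, fun i => ?_⟩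
  have hK1 : 1 ≤ i.kk := i.one_le
  have hK2 : 1 ≤ i.r + i.kk := hK1.trans (Nat.le_add_left _ _)
  have hMc : ∀ μ, cvM d L i.m i.kk hL μ = 2 * L ^ (i.m + 1) := fun μ => rfl
  have hd0 := unitTorusGeo_dist_nonneg L i.kk (cvM d L i.m i.kk hL)
  obtain ⟨hG1c, hD1c, hA1c⟩ := HK i.kk hK1 (L ^ i.kk) rfl (i.m + 1) (cvM d L i.m i.kk hL) hMc i.kk ι
  obtain ⟨hG1f, hD1f, hA1f⟩ := HK (i.r + i.kk) hK2 (L ^ i.r * L ^ i.kk) (pow_add L i.r i.kk).symm (i.m + 1) (cvM d L i.m i.kk hL) hMc i.kk ι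
  have hSc := HS (aK 1 (L : ℝ) i.kk) (haKlo i.kk hK1) (aK_le one_pos hL1r hK1) (cvM d L i.m i.kk hL) (L ^ i.kk) i.kk ι
  have hSf := HS (aK 1 (L : ℝ) (i.r + i.kk)) (haKlo (i.r + i.kk) hK2) (aK_le one_pos hL1r hK2) (cvM d L i.m i.kk hL) (L ^ i.r * L ^ i.kk) i.kk ι
  have hNc : (0 : ℝ) ≤ CS * ((L ^ i.kk : ℕ) : ℝ) ^ (d + 1) := by positivity
  have hNf : (0 : ℝ) ≤ CS * ((L ^ i.r * L ^ i.kk : ℕ) : ℝ) ^ (d + 1) := by positivity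
  exact ⟨aK 1 (L : ℝ) i.kk, aK 1 (L : ℝ) (i.r + i.kk), aK_pos one_pos hL1r hK1, aK_le one_pos hL1r hK1, aK_pos one_pos hL1r hK2, aK_le one_pos hL1r hK2,
    ⟨hG1c.of_rate_le hd0 hC.le (min_le_left _ _), hA1c.of_rate_le hd0 hC.le (min_le_left _ _), hD1c.of_rate_le hd0 hC.le (min_le_left _ _), hSc.of_rate_le hd0 hNc (min_le_right _ _)⟩,
    ⟨hG1f.of_rate_le hd0 hC.le (min_le_left _ _), hA1f.of_rate_le hd0 hC.le (min_le_left _ _), hD1f.of_rate_le hd0 hC.le (min_le_left _ _), hSf.of_rate_le hd0 hNf (min_le_right _ _)⟩⟩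

/-- ★★★★ **207b's THREE THRESHOLDED GLOBAL LANDAU ROWS FROM THE TWO-GRID DEFECT ROW ALONE** — every ONE-GRID row of the Landau letter `N_V^R` is a THEOREM (n15-c∕212–233: primitive-row
reduction, four flat rows PROVED, the covariant gradient row by the Leibniz route, letters from Reg335): `landauRows_small_of_flatRows''` ∘ `flatRows_two_grids`.  The socket all three layers
of the (P-R) literal plug into ((♭-3), (R8b)).  MODEL; the two-grid defect row is the ONE remaining HYPOTHESIS; NOT [B9] (3.49) as printed.
[cite: Balaban1985BackgroundPropagators, (3.49) p.399, Thm 3.14 pp.426–427 (shape of the remaining row)] -/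
theorem landauRows_small_of_defectRow (hL : Odd L ∧ 1 < L) (hL7 : 7 ≤ L) {a : ℝ} (ha : 0 < a) {c35 : ℝ} (hc35 : 0 < c35)
    (hD : ∃ δD CR γR aD : ℝ, 0 < δD ∧ 0 ≤ CR ∧ 0 < γR ∧ 0 < aD ∧
      ∀ i : SfIdx d L, ∀ α₀ : ℝ, 0 < α₀ → (L : ℝ) ^ i.m * α₀ ≤ aD → ∀ A' : Fin (d + 1) → CvX' d L i.m i.kk i.r hL → Matrix mm mm ℂ, (sfInstance d mm ι hL i).Bf.Reg335 c35 α₀ A' →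
        HasMaj (CvNorm d L i.m i.kk hL ι) (BlockNorm.ofBlocks (unitTorusGeo L i.kk (cvM d L i.m i.kk hL)) (liftBlk (cvBlk d L i.m i.kk hL ∘ (kingPrV L i.kk i.r (cvM d L i.m i.kk hL))) ι)) (idef (pull (liftMap (kingPrV L i.kk i.r (cvM d L i.m i.kk hL)) ι)) (pull (liftMap (kingPrV L i.kk i.r (cvM d L i.m i.kk hL)) ι)) (cvNVr' d L i.m i.kk i.r hL a ι e (fun μ x' => NormedSpace.exp (((((L ^ i.r * L ^ i.kk : ℕ) : ℝ))⁻¹) • A' μ x'))) (cvNVr d L i.m i.kk hL a ι e (fun μ x => NormedSpace.exp (((((L ^ i.kk : ℕ) : ℝ))⁻¹) • gavgM (Matrix mm mm ℂ) (Fin (d + 1)) (kingPrV L i.kk i.r (cvM d L i.m i.kk hL)) A' μ x)))) (fun y y' => (CR * ((L : ℝ) ^ i.kk) ^ (-γR)) * Real.exp (-(δD * (unitTorusGeo L i.kk (cvM d L i.m i.kk hL)).dist y y')))) :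
    ∃ δR cR CR γR aG : ℝ, 0 < δR ∧ 0 ≤ cR ∧ 0 ≤ CR ∧ 0 < γR ∧ 0 < aG ∧
      ∀ i : SfIdx d L, ∀ α₀ : ℝ, 0 < α₀ → (L : ℝ) ^ i.m * α₀ ≤ aG → ∀ A' : Fin (d + 1) → CvX' d L i.m i.kk i.r hL → Matrix mm mm ℂ, (sfInstance d mm ι hL i).Bf.Reg335 c35 α₀ A' →
        HasMaj (CvNorm d L i.m i.kk hL ι) (CvNorm d L i.m i.kk hL ι) (cvNVr d L i.m i.kk hL a ι e (fun μ x => NormedSpace.exp (((((L ^ i.kk : ℕ) : ℝ))⁻¹) • gavgM (Matrix mm mm ℂ) (Fin (d + 1)) (kingPrV L i.kk i.r (cvM d L i.m i.kk hL)) A' μ x))) (fun y y' => (cR * (c35 * (L : ℝ) ^ i.m * α₀)) * Real.exp (-(δR * (unitTorusGeo L i.kk (cvM d L i.m i.kk hL)).dist y y'))) ∧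
        HasMaj (BlockNorm.ofBlocks (unitTorusGeo L i.kk (cvM d L i.m i.kk hL)) (liftBlk (cvBlk d L i.m i.kk hL ∘ (kingPrV L i.kk i.r (cvM d L i.m i.kk hL))) ι)) (BlockNorm.ofBlocks (unitTorusGeo L i.kk (cvM d L i.m i.kk hL)) (liftBlk (cvBlk d L i.m i.kk hL ∘ (kingPrV L i.kk i.r (cvM d L i.m i.kk hL))) ι)) (cvNVr' d L i.m i.kk i.r hL a ι e (fun μ x' => NormedSpace.exp (((((L ^ i.r * L ^ i.kk : ℕ) : ℝ))⁻¹) • A' μ x'))) (fun y y' => (cR * (c35 * (L : ℝ) ^ i.m * α₀)) * Real.exp (-(δR * (unitTorusGeo L i.kk (cvM d L i.m i.kk hL)).dist y y'))) ∧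
        HasMaj (CvNorm d L i.m i.kk hL ι) (BlockNorm.ofBlocks (unitTorusGeo L i.kk (cvM d L i.m i.kk hL)) (liftBlk (cvBlk d L i.m i.kk hL ∘ (kingPrV L i.kk i.r (cvM d L i.m i.kk hL))) ι)) (idef (pull (liftMap (kingPrV L i.kk i.r (cvM d L i.m i.kk hL)) ι)) (pull (liftMap (kingPrV L i.kk i.r (cvM d L i.m i.kk hL)) ι)) (cvNVr' d L i.m i.kk i.r hL a ι e (fun μ x' => NormedSpace.exp (((((L ^ i.r * L ^ i.kk : ℕ) : ℝ))⁻¹) • A' μ x'))) (cvNVr d L i.m i.kk hL a ι e (fun μ x => NormedSpace.exp (((((L ^ i.kk : ℕ) : ℝ))⁻¹) • gavgM (Matrix mm mm ℂ) (Fin (d + 1)) (kingPrV L i.kk i.r (cvM d L i.m i.kk hL)) A' μ x)))) (fun y y' => (CR * ((L : ℝ) ^ i.kk) ^ (-γR)) * Real.exp (-(δR * (unitTorusGeo L i.kk (cvM d L i.m i.kk hL)).dist y y'))) :=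
  landauRows_small_of_flatRows'' d mm ι e hL hL7 ha hc35 (flatRows_two_grids d ι hL hL7) hD

set_option maxRecDepth 8192 in
/-- ★★★★ **`NE2PlusOperator` FOR THE (P-R) FAMILY WITH ALL FOUR ENTRIES CONCRETE, MODULO ONLY THE TWO-GRID η-DEFECT ROW OF `N_V^R`** — (R8a) `ne2PlusOperator_sfqr₄E` ∘
`landauRows_small_of_defectRow`: Bałaban's WHOLE covariant summand live in the propagator, all four entries of (3.42) constructed, every one-grid Landau row a theorem.  MODEL family;
NOT [B9] Thms 3.1–3.4 ∕ 3.14 as printed. [cite: Balaban1985BackgroundPropagators, Thm 3.1 (3.42) p.397, (3.49) p.399 (templates: MODEL level)] -/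
theorem ne2PlusOperator_sfqr₄E_of_defectRow (hL : Odd L ∧ 1 < L) (hL7 : 7 ≤ L) {a : ℝ} (ha : 0 < a) {c35 : ℝ} (hc35 : 0 < c35) (he : ∀ A B : Matrix mm mm ℂ, traceForm A B = e A ⬝ᵥ e B)
    (μ₁ μ₂ : Fin (d + 1))
    (hD : ∃ δD CR γR aD : ℝ, 0 < δD ∧ 0 ≤ CR ∧ 0 < γR ∧ 0 < aD ∧
      ∀ i : SfIdx d L, ∀ α₀ : ℝ, 0 < α₀ → (L : ℝ) ^ i.m * α₀ ≤ aD → ∀ A' : Fin (d + 1) → CvX' d L i.m i.kk i.r hL → Matrix mm mm ℂ, (sfInstance d mm ι hL i).Bf.Reg335 c35 α₀ A' →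
        HasMaj (CvNorm d L i.m i.kk hL ι) (BlockNorm.ofBlocks (unitTorusGeo L i.kk (cvM d L i.m i.kk hL)) (liftBlk (cvBlk d L i.m i.kk hL ∘ (kingPrV L i.kk i.r (cvM d L i.m i.kk hL))) ι)) (idef (pull (liftMap (kingPrV L i.kk i.r (cvM d L i.m i.kk hL)) ι)) (pull (liftMap (kingPrV L i.kk i.r (cvM d L i.m i.kk hL)) ι)) (cvNVr' d L i.m i.kk i.r hL a ι e (fun μ x' => NormedSpace.exp (((((L ^ i.r * L ^ i.kk : ℕ) : ℝ))⁻¹) • A' μ x'))) (cvNVr d L i.m i.kk hL a ι e (fun μ x => NormedSpace.exp (((((L ^ i.kk : ℕ) : ℝ))⁻¹) • gavgM (Matrix mm mm ℂ) (Fin (d + 1)) (kingPrV L i.kk i.r (cvM d L i.m i.kk hL)) A' μ x)))) (fun y y' => (CR * ((L : ℝ) ^ i.kk) ^ (-γR)) * Real.exp (-(δD * (unitTorusGeo L i.kk (cvM d L i.m i.kk hL)).dist y y')))) :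
    NE2PlusOperator c35 (sfInstance d mm ι hL) (fun i => sfqrFamily d mm ι a e hL i (sfqrE₄ d mm ι e hL a μ₁ μ₂ i)) :=
  ne2PlusOperator_sfqr₄E d mm ι e hL hL7 ha hc35 he μ₁ μ₂ (landauRows_small_of_defectRow d mm ι e hL hL7 ha hc35 hD)

end Node

end Summit.QuantumFields.YangMills.BalabanUVNodes.N15.Gluing

end
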